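import Summits.BirchSwinnertonDyer.BirchSwinnertonDyer.Theorems.AdditiveBranchIMCGordTwoRankOneHeegnerKolyvaginManinFree
import Summits.BirchSwinnertonDyer.Rank1Residual.Additive.WildThreeRefinedKolyvagin
import Summits.BirchSwinnertonDyer.Rank1Residual.Additive.PotSupersingularClasses
import Literature.NumberTheory.EllipticCurves.HeegnerPointReflectionProofs
import HarnessLib

/-!
# Route `RamifiedHeegnerPair`, deciding crux L₁ `Gss2LowerAtThreeRankOne` (stmt-BirchSwinnertonDyer-26021; = skeleton v3
# `stub_gssLowerAtThree_rankOne` of the aside X1 `RamifiedPairLowerBound`, stmt-23191) — the SPLIT-FIELD KOLYVAGIN ROAD: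
# L₁ on the 3-adic-tower rows from PUBLISHED facts + ONE BSD-consistent Heegner-index input (the ADJUSTED STEP L at 3),
# and that input from Kolyvagin's structure theorem (lower one-class form) + 3-INDIVISIBILITY of the Kolyvagin system

HONEST FRAMING. Theorems only; helper file (`--supports stmt-BirchSwinnertonDyer-26021`); no definition, no named fact, no
`sorry`; nothing is booked, no item is closed, BSD is not proved for any curve; CONDITIONAL on every displayed input.
Lead prover bsd-line-rhp-p1 g3 (successor by lineage of g0/g2), 2026-08-28.

WHY THIS FILE. The lineage's memo (LOWER-HALVES-CORE.md §2, g2) read L₁ — `ord₃ #Ш(E)_an ≤ ord₃ #Ш(E)` for every non-CM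
globally minimal `E/ℚ` additive of class Gss2 at `3` (`Addv E 3 ∧ SubGss E 3`: `E = V₀ ⊗ χ₋₃`, `V₀` good supersingular,
Kodaira `I₀*`) with `r_an(E) = 1` — as needing «a 3-adic Gross–Zagier formula on the ω-branch / the signed anticyclotomic
IMC ⊇ over the 3-RAMIFIED `K = ℚ(√d)`; nothing in print or announced», and left its §6 («exact 3-indivisibility of the
CM-point index = Kolyvagin's structure theorem») un-typed. It IS typed — for the sister cell (G-ord, `e = 2`) — by the
`AdditiveBranchIMC` lane (`…GordTwoRankOneHeegnerKolyvagin{Twist,ManinKept,ManinFree,StepL}.lean`): Jetchev–Skinner–Wan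
§7.4.1 run at an ADDITIVE potentially good prime `p` (EVERY odd `p`, `p = 3` included; the reduction TYPE above `p` never
enters): over a SPLIT Heegner field `K′` (every `ℓ ∣ N_E` split, so `3` splits; Friedberg–Hoffstein with
`L(E^{(d_{K′})},1) ≠ 0`), the rank-zero twist `E^{(d_{K′})}` is AGAIN additive potentially good at `p` with the same
`p`-adic image, Kato 2004 Thm. 14.5 (3) + Prop. 14.16 (2) in the Tamagawa-EXACT reading
(`Kato2004.rankZero_padicValNat_sha_add_padicValNat_tamagawa_le_of_additive_potGood_of_imageContainsSL2`, print) pays its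
UPPER half, Gross–Zagier I.(6.3)/(7.3) does the bookkeeping, and the ONLY non-published input is the BSD-consistent
ADJUSTED index bound at ONE Heegner datum,
  `2·ord₃[E(K′):ℤP] ≤ ord₃ #Ш(E/K′) + ord₃ ∏_ℓ c_ℓ(E) + ord₃ ∏_ℓ c_ℓ(Wd) + 2·ord₃ c(Dt)`      (ADJUSTED STEP L at `3`)
(`Wd` a minimal model of `E^{(d_{K′})}`, `c(Dt)` the parametrisation constant; predicted WITH EQUALITY by
`BSD₃(E) ∧ BSD₃(E^{(d_{K′})})`). This file reads that road on the Gss2 leaf at `p = 3` and feeds its input from the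
Heegner side:

* §1 `gssLowerAtThree_rankOne_towerRows_of_adjustedIndexBound` — L₁ on the rows with `ρ_{E,3^n}` onto for all `n`
  (⟸ `surj(9)`, `forall_hasSurjectiveModNGaloisRep_three_pow_of_nine`; all 9 intrinsic r1 classes of the census have
  `ρ̄₃` onto) ⟸ PUB ∧ [ADJUSTED STEP L at every Heegner datum of every such row]. No `Λ`-adic object, no `p`-adic height,
  no signed Coleman map, no ramified field, no Tamagawa / Manin condition.
* §2 `adjustedIndexBound_three_of_oneClassLowerBound_of_not_minftyGe` — at a datum: Kolyvagin's STRUCTURE theorem at `3`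
  in its one-sided lower form (`AdditiveThree.OneClassLowerBoundShape`: ONE Kolyvagin class `c_M(n)` not
  `3^{m+1}`-divisible ⇒ `2·ord₃[E(K′):ℤP] ≤ ord₃ #Ш(E/K′) + 2m`; McCallum 1991 Thm. 5.4/5.8, tower surjectivity,
  `d_{K′} ∉ {−3,−4}`, `P = y_{K′}` non-torsion; typed by cell b2b/o5o6, `p ∣ N` reading flagged) + 3-INDIVISIBILITY of the
  Kolyvagin system WITHIN THE BSD BUDGET (`¬ MinftyGe E K′ Dt H.β ι (m+1)` for some `m` with
  `2m ≤ ord₃∏c(E) + ord₃∏c(Wd) + 2·ord₃ c(Dt)`; = the indivisibility half T1⁻ of the refined Kolyvagin conjecture at an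
  additive `3`, `AdditiveThree.RKC3Indivisibility`-shape with the Manin slack and the twist's Tamagawa defect displayed;
  W. Zhang 2014 / BCGS 2026 prove it for good ordinary `p ≥ 5`, `p ∤ N`; OPEN at `3 ∣ N`; CERTIFIABLE PAIR BY PAIR by
  exhibiting one derived class, Jetchev–Lauter–Stein 2009 §4) ⟹ the adjusted bound.
* §3 `gssLowerAtThree_rankOne_towerRows_of_structure_of_indivisibility` — THE ROAD: PUB ∧ structure (lower form) ∧
  indivisibility on the Gss2 r1 tower-row Heegner data ⟹ L₁ on the tower rows.
* (companion file `…KolyvaginRoadByName.lean`, which imports the route file) the crux `Gss2LowerAtThreeRankOne` BY NAME,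
  with the NON-tower rows (no `surj(9)`: `ρ̄₃` not onto on 98 of the 355 r1 classes, or onto with 3-adic image of index
  3/27 — Elkies) DISPLAYED as the residual hypothesis `hNT`. THIS file imports NO `Theses` file of this route (its cone
  holds `Theses.AdditiveBranchIMC` through the k1-c3x doors only), so other Gss2-at-3 programmes can use it.

READING FOR THE PLANNER. On the tower rows L₁'s research content is ONE statement about Heegner points over a SPLIT field —
the adjusted STEP L, alias «`M_∞ ≤ ½(ord₃∏c(E) + ord₃∏c(E^{d_{K′}})) + ord₃ c`» — exactly dual to rhp-p2's reading of
U₁ (`LeafRankOneUpperAtThree`, 26022: co-socket `IndexUpperBoundLeAt` / `RKC3Divisibility`-shape global divisibility +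
L₀ of the twist, p606327/p607034): L₁ ∧ U₁ on the tower rows = the two halves of the REFINED KOLYVAGIN CONJECTURE at an
additive `3` (`AdditiveThree.RefinedKolyvaginAdditiveThree`, cell b2b) + print + L₀ (for U₁ only). The 3-ramified
field of the thesis is not used by either half. Seven of the nine intrinsic r1 classes (182853c, 228897c, 250065g,
355338h, 409248cy, 439794p, 205128l) already carry KERNEL `BSDp E 3` records (`…HeegnerKolyvaginGss2Records{A–D,FieldA/B,Tam}`,
lane bsd-addord-k1-c3x g9, instance-grade). CONDITIONAL; the ∀-statements stay OPEN.

References: [cite: JetchevSkinnerWan2017, §7.4.1 (arXiv:1512.06894 pp. 29–31)] [cite: Kato2004Asterisque, Thm. 14.5 (3)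
(p. 236), Prop. 14.16 (2) (p. 244), (12.5.2) (p. 222)] [cite: McCallumLMS1991, Thm. 5.4 (p. 288), Thm. 5.8 (p. 290), §1]
[cite: GrossZagier1986, Thm. I.(6.3), V.§2] [cite: FriedbergHoffstein1995, Thm. B] [cite: WZhang2014, Thm. 1.1, §3.8,
Thm. 10.2, Remark 18] [cite: Jetchev2008, Conj. 1.3, Thm. 1.4] [cite: JetchevLauterStein2009, Prop. 4.1–4.2]
[cite: Darmon2004, Thm. 3.6 and §3.7] [cite: Miller2011LMS, Def. 1.1] [cite: SerreAbelianLadic1968, IV §3.4 Lemma 3].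
-/

-- D-0017: single-problem summit, so `Summit.BirchSwinnertonDyer.BirchSwinnertonDyer.…` repeats a namespace BY DESIGN.
set_option linter.dupNamespace false
set_option autoImplicit false

noncomputable section

open scoped Classical NumberField

open WeierstrassCurve NumberField IsDedekindDomain
  Literature.NumberTheory.EllipticCurves Literature.NumberTheory.EllipticCurves.ModularForms
  Literature.NumberTheory.EllipticCurves.Rank1Residual
  Literature.NumberTheory.EllipticCurves.Rank1Residual.Typed
  Summit.BirchSwinnertonDyer.Rank1Residual
  Summit.BirchSwinnertonDyer.Rank1Residual.Additive
  Summit.BirchSwinnertonDyer.Rank1Residual.X11b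
  Summit.BirchSwinnertonDyer.Rank1Residual.GaloisImage
  Literature.NumberTheory.Automorphic
  Summit.BirchSwinnertonDyer.BirchSwinnertonDyer.Theorems.AdditiveBranchIMCGordTwoRankOne

namespace Summit.BirchSwinnertonDyer.BirchSwinnertonDyer.Theorems.RamifiedPairLowerBound

/-! ## §0 The pointwise door at a Gss2 prime `3` (adapted from k1-c3x `…HeegnerKolyvaginStepL` §14–§15, kept Theses-free) -/

/-- **The LOWER half of a rank-one Gss2-at-3 curve from the ADJUSTED index bound at ONE Heegner datum — pointwise door.**
Data: `W/ℚ` globally minimal, additive (G) ∧ ss at `3`, `r_an(W) = 1`, `ρ_{W,3^n}` onto for all `n`; `K` imaginary quadratic,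
Heegner for `N_W` (so `3` splits), `3 ∤ #𝓞_K^×`, `L(W^{(d_K)},1) ≠ 0`; `P ∈ E(K)` over the complex Heegner point of ANY
datum `(Dt, H, ι)` at level `N_W`; `Wd = Cd • W^{(d_K)}` globally minimal. PUBLISHED binders `hGZ hKo hKatoT hGZK hmod`.
TYPED INPUT `hL'`: `2·ord₃[E(K):ℤP] ≤ ord₃ #Ш(E/K) + ord₃∏c(W) + ord₃∏c(Wd) + 2·ord₃ c(Dt)` granted `Ш(E/K)` finite.
CONCLUSION `Typed.MissingLowerBoundAt W 3`. Proof = k1-c3x's `missingLowerBoundAt_of_adjustedIndexBound` ∘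
`missingLowerBoundAt_rankOne_additive_of_adjustedIndexBound` (route `AdditiveBranchIMC`, Part 6) read at `p = 3` on the
Gss2 row — re-derived here over the Theses-free Parts 1/4 (`exists_shaAn_padicVal_eq_of_heegner_maninKept`, the twist
transports, Kato Tamagawa-exact for the twist) so that this file imports no route file: `v(q) = 2v(I) − v(q_d) − v(c_W) −
2v(t_d) − 2v(c) ≤ v(Ш_W) + v(Ш_d) + v(c_d) − v(q_d) − 2v(t_d) ≤ v(Ш_W)`. [cite: JetchevSkinnerWan2017, §7.4.1 (pp. 29–31)]
[cite: Kato2004Asterisque, Thm. 14.5 (3) (p. 236), Prop. 14.16 (2) (p. 244)] [cite: GrossZagier1986, V.§2] [cite: Miller2011LMS, Def. 1.1] -/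
theorem missingLowerBoundAt_three_rankOne_gss_of_adjustedIndexBound
    (W : WeierstrassCurve ℚ) [W.IsElliptic] [W.IsGloballyMinimal] [NeZero (W.conductorNorm ℤ)]
    (K : Type) [Field K] [NumberField K]
    (Dt : ModularParametrizationData W (W.conductorNorm ℤ))
    (H : HeegnerDatum (W.conductorNorm ℤ) (NumberField.discr K)) (ι : K →+* ℂ)
    (P : (W.baseChange K).toAffine.Point)
    (hGZ : gross_zagier (W.conductorNorm ℤ) W K) (hKo : kolyvagin (W.conductorNorm ℤ) W K)
    (hKatoT : Kato2004.rankZero_padicValNat_sha_add_padicValNat_tamagawa_le_of_additive_potGood_of_imageContainsSL2)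
    (hGZK : rank_eq_analyticRank_of_analyticRank_le_one) (hmod : hasEntireLFunction_rat)
    (hadd : Addv W 3) (hsub : SubGss W 3) (hr : W.analyticRank = 1)
    (hsurj : ∀ n : ℕ, W.HasSurjectiveModNGaloisRep (3 ^ n : ℕ))
    (hK : IsImaginaryQuadratic K) (hHN : SatisfiesHeegnerHypothesis (W.conductorNorm ℤ) K)
    (hP : WeierstrassCurve.Affine.Point.map ι.toRatAlgHom P = heegnerPointComplex Dt H)
    (hμ : ¬ 3 ∣ Units.torsionOrder K)
    (hLt : (W.quadraticTwist (NumberField.discr K : ℚ)).entireLFunction 1 ≠ 0)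
    (Wd : WeierstrassCurve ℚ) [Wd.IsElliptic] [Wd.IsGloballyMinimal] (Cd : VariableChange ℚ)
    (hWd : Cd • W.quadraticTwist (NumberField.discr K : ℚ) = Wd)
    (hL' : Finite (W.baseChange K).sha →
      (2 * padicValNat 3 (AddSubgroup.zmultiples P).index : ℤ) ≤
        padicValNat 3 (W.baseChange K).shaOrder + padicValNat 3 W.tamagawaProduct +
          padicValNat 3 Wd.tamagawaProduct + 2 * padicValRat 3 (Dt.c : ℚ)) :
    MissingLowerBoundAt W 3 := by
  -- adapted from k1-c3x `missingLowerBoundAt_rankOne_additive_of_adjustedIndexBound` (StepL §15) at `p = 3`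
  haveI : Fact (Nat.Prime 3) := ⟨Nat.prime_three⟩
  have hp2 : (3 : ℕ) ≠ 2 := by decide
  have hj : 0 ≤ padicValRat 3 W.j := not_lt.mp hsub.1.1
  have hD0 : (NumberField.discr K : ℚ) ≠ 0 := by exact_mod_cast NumberField.discr_ne_zero K
  haveI hEt : (W.quadraticTwist (NumberField.discr K : ℚ)).IsElliptic := W.isElliptic_quadraticTwist hD0
  -- the rank-zero twist is again additive potentially good at `3` with the same 3-adic image
  have haddd : Addv Wd 3 := HeegnerKolyvagin.addv_twist_of_heegner W 3 K hK hHN hadd Cd hWd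
  have hjd : 0 ≤ padicValRat 3 Wd.j := by
    have hjeq : Wd.j = W.j := by subst hWd; rw [variableChange_j, W.j_quadraticTwist hD0]
    rw [hjeq]; exact hj
  have hsurjd : ∀ n : ℕ, Wd.HasSurjectiveModNGaloisRep (3 ^ n : ℕ) := fun n ↦
    (hasSurjectiveModNGaloisRep_pow_iff_of_model_twist W 3 hD0 ⟨Cd, hWd⟩ n).mpr (hsurj n)
  have hu : padicValRat 3 (Cd.u : ℚ) = 0 :=
    HeegnerKolyvagin.padicValRat_u_eq_zero_of_twist_minimal' W 3 K hK hHN hadd.1 Cd hWd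
  have hLt' : (W.quadraticTwist (NumberField.discr K : ℚ)).entireLFunction = Wd.entireLFunction := by
    rw [← hWd, entireLFunction_smul]
  have hLd1 : Wd.entireLFunction 1 ≠ 0 := by rw [← hLt']; exact hLt
  -- Kato Tamagawa-exact for the twist (print): `v(Ш_d) + v(c_d) − 2v(t_d) ≤ v(q_d)`
  obtain ⟨qd, hqd, hvqd⟩ :=
    HeegnerKolyvagin.twist_le_half_of_katoTamagawaExact hKatoT hGZK hmod Wd 3 hp2 haddd hjd hsurjd hLd1
  -- the Manin-kept Gross–Zagier bookkeeping identity (Part 4), and the adjusted bound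
  obtain ⟨-, hfinK, hsha, q, hq, hval⟩ := HeegnerKolyvagin.exists_shaAn_padicVal_eq_of_heegner_maninKept W 3
    (W.conductorNorm ℤ) K Dt H ι P hGZ hKo hGZK hmod hK hHN hP hp2 hμ hr hLt Wd Cd hWd hu qd hqd
  have e1 := hL' hfinK
  refine ⟨q, hq, ?_⟩
  have e2 : (padicValNat 3 (W.baseChange K).shaOrder : ℤ) =
      padicValNat 3 W.shaOrder + padicValNat 3 Wd.shaOrder := by exact_mod_cast hsha
  linarith

/-! ## §1 L₁ on the 3-adic-tower rows from PUBLISHED facts + the ADJUSTED STEP L at 3 (socket form) -/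

/-- **L₁ on the tower rows of the Gss2 leaf ⟸ PUB ∧ ADJUSTED STEP L.** PUBLISHED binders (named facts of the tree, taken
as hypotheses): Gross–Zagier `hGZ`, Kolyvagin (qualitative) `hKo`, Kato 2004 Thm. 14.5 (3) + Prop. 14.16 (2)
Tamagawa-exact at an additive potentially good prime `hKatoT` (for the rank-`0` TWIST), GZK `hGZK`, modularity `hmod`/`hnf`
(root number `−1`)/`hmodP` (a parametrisation at the conductor level, ANY Manin constant), Friedberg–Hoffstein `hFH`
(a Heegner field `K′` with every `ℓ ∣ N_E` split, `|d_{K′}| > 4`, `L(E^{(d_{K′})},1) ≠ 0`). TYPED INPUT `hL'`: the ADJUSTED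
STEP L `2·ord₃[E(K′):ℤP] ≤ ord₃ #Ш(E/K′) + ord₃∏c(E) + ord₃∏c(Wd) + 2·ord₃ c(Dt)` at every Heegner datum
`(K′, Dt, H, ι, P)` and minimal twist model `Wd` of every row below, granted finiteness of `Ш(E/K′)` (OPEN at an additive
`3`; BSD-consistent with equality). CONCLUSION: for every globally minimal `E/ℚ` additive at `3` of census class (G) ∧ ss
(`SubGss`), `r_an(E) = 1`, `ρ_{E,3^n}` onto for all `n`: `Typed.MissingLowerBoundAt E 3`. The Gss2-at-3 reading of
`AdditiveBranchIMCGordTwoRankOne.HeegnerKolyvagin.cellGordTwo_missingLowerBoundAt_rankOne_of_towerSurj_of_adjustedIndexBound`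
(same proof; `0 ≤ ord₃ j` is `SubGss`'s (G) clause). [cite: JetchevSkinnerWan2017, §7.4.1 (arXiv:1512.06894 pp. 29–31)]
[cite: Kato2004Asterisque, Thm. 14.5 (3) (p. 236)] [cite: Darmon2004, Thm. 3.6 and §3.7] [cite: Miller2011LMS, Def. 1.1] -/
theorem gssLowerAtThree_rankOne_towerRows_of_adjustedIndexBound
    (hGZ : ∀ (N : ℕ) [NeZero N] (W : WeierstrassCurve ℚ) (K : Type) [Field K] [NumberField K],
      gross_zagier N W K)
    (hKo : ∀ (N : ℕ) [NeZero N] (W : WeierstrassCurve ℚ) (K : Type) [Field K] [NumberField K],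
      kolyvagin N W K)
    (hKatoT : Kato2004.rankZero_padicValNat_sha_add_padicValNat_tamagawa_le_of_additive_potGood_of_imageContainsSL2)
    (hGZK : rank_eq_analyticRank_of_analyticRank_le_one) (hmod : hasEntireLFunction_rat)
    (hnf : exists_isNewformOf) (hmodP : nonempty_modularParametrizationData)
    (hFH : friedbergHoffstein_exists_heegnerField_split_twist_ne_zero)
    (hL' : ∀ (W : WeierstrassCurve ℚ) [W.IsElliptic] [W.IsGloballyMinimal]
      (N : ℕ) [NeZero N] (K : Type) [Field K] [NumberField K]
      (Dt : ModularParametrizationData W N) (H : HeegnerDatum N (NumberField.discr K)) (ι : K →+* ℂ)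
      (P : (W.baseChange K).toAffine.Point)
      (Wd : WeierstrassCurve ℚ) [Wd.IsElliptic] [Wd.IsGloballyMinimal] (Cd : VariableChange ℚ),
      Addv W 3 → SubGss W 3 → W.analyticRank = 1 → (∀ n : ℕ, W.HasSurjectiveModNGaloisRep (3 ^ n : ℕ)) →
      W.conductorNorm ℤ = N → IsImaginaryQuadratic K → SatisfiesHeegnerHypothesis N K →
      (W.quadraticTwist (NumberField.discr K : ℚ)).entireLFunction 1 ≠ 0 →
      WeierstrassCurve.Affine.Point.map ι.toRatAlgHom P = heegnerPointComplex Dt H →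
      Cd • W.quadraticTwist (NumberField.discr K : ℚ) = Wd →
      Finite (W.baseChange K).sha →
      (2 * padicValNat 3 (AddSubgroup.zmultiples P).index : ℤ) ≤
        padicValNat 3 (W.baseChange K).shaOrder + padicValNat 3 W.tamagawaProduct +
          padicValNat 3 Wd.tamagawaProduct + 2 * padicValRat 3 (Dt.c : ℚ)) :
    ∀ (W : WeierstrassCurve ℚ) [W.IsElliptic] [W.IsGloballyMinimal],
      Addv W 3 → SubGss W 3 → W.analyticRank = 1 →
      (∀ n : ℕ, W.HasSurjectiveModNGaloisRep (3 ^ n : ℕ)) → MissingLowerBoundAt W 3 := by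
  intro W _ _ hadd hsub hr hsurj
  haveI : Fact (Nat.Prime 3) := ⟨Nat.prime_three⟩
  haveI : NeZero (W.conductorNorm ℤ) := ⟨(W.conductorNorm_pos_holds).ne'⟩
  -- the sign of the functional equation is `−1` (modularity, `r_an = 1`)
  have hw : W.rootNumber = -1 := by
    rw [WeierstrassCurve.rootNumber_eq_neg_one_pow_analyticRank_of_exists_isNewformOf hnf W, hr]
    norm_num
  -- the auxiliary SPLIT Heegner field (Friedberg–Hoffstein): every `ℓ ∣ N` split, `|d_K| > 4`, `L(E^{d_K},1) ≠ 0`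
  obtain ⟨K, _, _, hK, hdisc, hHN, -, hLt⟩ := hFH W hw 3 Nat.prime_three 4
  -- `w_K = 2`, prime to `3`
  have hμ : ¬ 3 ∣ Units.torsionOrder K := by
    haveI : IsTotallyComplex K := hK.2
    have hneg : NumberField.discr K < 0 := discr_neg_of_finrank_eq_two K hK.1
    have habs : ((NumberField.discr K).natAbs : ℤ) = -NumberField.discr K :=
      Int.ofNat_natAbs_of_nonpos hneg.le
    have h4 : NumberField.discr K < -4 := by
      have : (4 : ℤ) < ((NumberField.discr K).natAbs : ℤ) := by exact_mod_cast hdisc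
      omega
    rw [Literature.NumberTheory.DiophantineGeometry.torsionOrder_eq_two_of_discr_lt hK.1 h4]
    decide
  -- a Heegner datum: ANY parametrisation at the conductor level, a Heegner datum of discriminant `d_K`, an embedding,
  -- and the Heegner point over `K` (Gross 1984 §I.1; Darmon 2004 Thm. 3.6)
  obtain ⟨Dt⟩ := hmodP W
  obtain ⟨β, hβ⟩ := exists_dvd_sq_sub_discr_holds (W.conductorNorm ℤ) K hK hHN
  obtain ⟨H, -⟩ := nonempty_heegnerDatum_holds (W.conductorNorm ℤ) K hK hβ
  obtain ⟨ι⟩ : Nonempty (K →+* ℂ) := inferInstance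
  obtain ⟨P, hP⟩ := heegnerPointComplex_mem_range_map_holds (W.conductorNorm ℤ) W K hK hHN Dt H ι
  -- a globally minimal model of the twist (Néron)
  have hD0 : (NumberField.discr K : ℚ) ≠ 0 := by exact_mod_cast NumberField.discr_ne_zero K
  haveI hEt : (W.quadraticTwist (NumberField.discr K : ℚ)).IsElliptic := W.isElliptic_quadraticTwist hD0
  obtain ⟨Cd, hCd⟩ := hasGlobalMinimalModel_rat_holds (W.quadraticTwist (NumberField.discr K : ℚ))
  haveI : (Cd • W.quadraticTwist (NumberField.discr K : ℚ)).IsGloballyMinimal := hCd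
  have hWd : Cd • W.quadraticTwist (NumberField.discr K : ℚ) =
      Cd • W.quadraticTwist (NumberField.discr K : ℚ) := rfl
  exact missingLowerBoundAt_three_rankOne_gss_of_adjustedIndexBound W K Dt H ι P (hGZ _ W K) (hKo _ W K) hKatoT hGZK
    hmod hadd hsub hr hsurj hK hHN hP hμ hLt (Cd • W.quadraticTwist (NumberField.discr K : ℚ)) Cd hWd
    (hL' W _ K Dt H ι P (Cd • W.quadraticTwist (NumberField.discr K : ℚ)) Cd hadd hsub hr hsurj rfl hK hHN
      hLt hP hWd)

/-! ## §2 The adjusted STEP L at a datum from Kolyvagin's structure theorem (lower one-class form) + 3-INDIVISIBILITY -/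

/-- **ADJUSTED STEP L at `3` from ONE indivisible Kolyvagin class within the BSD budget.** At a datum
`(W, K′, Dt, H, ι, P)` in the structure theorem's frame (`ρ_{E,3^n}` onto for all `n`, `K′` imaginary quadratic with
`d_{K′} ∉ {−3,−4}` and the Heegner hypothesis for `N_E`, `P ∈ E(K′)` over the complex Heegner point of `(Dt, H, ι)`, of
infinite order) and for any `Wd/ℚ`: Kolyvagin's structure theorem in its one-sided lower form
(`AdditiveThree.OneClassLowerBoundShape`, hypothesis `hSL`) and the existence of a budget `m`,
`2m ≤ ord₃∏c(E) + ord₃∏c(Wd) + 2·ord₃ c(Dt)`, with SOME genuine Kolyvagin class not `3^{m+1}`-divisible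
(`¬ MinftyGe … (m+1)`) give `2·ord₃[E(K′):ℤP] ≤ ord₃ #Ш(E/K′) + ord₃∏c(E) + ord₃∏c(Wd) + 2·ord₃ c(Dt)`. Arithmetic only;
the structure theorem is a HYPOTHESIS. [cite: McCallumLMS1991, Thm. 5.4 (p. 288), Thm. 5.8 (p. 290)]
[cite: WZhang2014, §3.8 (p. 213), Thm. 10.2 and Remark 18] [cite: JetchevSkinnerWan2017, §7.4.1 (eq:shalowerK-1)] -/
theorem adjustedIndexBound_three_of_oneClassLowerBound_of_not_minftyGe
    (hSL : AdditiveThree.OneClassLowerBoundShape)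
    (W : WeierstrassCurve ℚ) [W.IsElliptic] [W.IsGloballyMinimal] [NeZero (W.conductorNorm ℤ)]
    (hρ : ∀ n : ℕ, W.HasSurjectiveModNGaloisRep (3 ^ n : ℕ))
    (K : Type) [Field K] [NumberField K] (hK : IsImaginaryQuadratic K)
    (h3 : NumberField.discr K ≠ -3) (h4 : NumberField.discr K ≠ -4)
    (hHN : SatisfiesHeegnerHypothesis (W.conductorNorm ℤ) K)
    (Dt : ModularParametrizationData W (W.conductorNorm ℤ))
    (H : HeegnerDatum (W.conductorNorm ℤ) (NumberField.discr K)) (ι : K →+* ℂ)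
    (P : (W.baseChange K).toAffine.Point)
    (hP : WeierstrassCurve.Affine.Point.map ι.toRatAlgHom P = heegnerPointComplex Dt H)
    (hnt : ¬ IsOfFinAddOrder P) (Wd : WeierstrassCurve ℚ)
    (hInd : ∃ m : ℕ, 2 * m ≤ padicValNat 3 W.tamagawaProduct + padicValNat 3 Wd.tamagawaProduct +
        2 * padicValNat 3 Dt.c.natAbs ∧ ¬ AdditiveThree.MinftyGe W K Dt H.β ι (m + 1)) :
    (2 * padicValNat 3 (AddSubgroup.zmultiples P).index : ℤ) ≤
      padicValNat 3 (W.baseChange K).shaOrder + padicValNat 3 W.tamagawaProduct +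
        padicValNat 3 Wd.tamagawaProduct + 2 * padicValRat 3 (Dt.c : ℚ) := by
  obtain ⟨m, hm, hnot⟩ := hInd
  have htower : AdditiveThree.TowerSurjThree W := fun n _ ↦ hρ n
  have h := hSL W htower K hK h3 h4 hHN Dt H ι P hP hnt m hnot
  have hc : padicValRat 3 (Dt.c : ℚ) = (padicValNat 3 Dt.c.natAbs : ℤ) := by
    rw [padicValRat.of_int]; rfl
  rw [hc]
  have h' : (2 * padicValNat 3 (AddSubgroup.zmultiples P).index : ℤ) ≤
      padicValNat 3 (W.baseChange K).shaOrder + 2 * m := by exact_mod_cast h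
  have hm' : (2 * m : ℤ) ≤ padicValNat 3 W.tamagawaProduct + padicValNat 3 Wd.tamagawaProduct +
      2 * padicValNat 3 Dt.c.natAbs := by exact_mod_cast hm
  linarith

/-! ## §3 THE ROAD: PUB ∧ structure (lower form) ∧ 3-indivisibility on the Gss2 r1 tower-row Heegner data ⟹ L₁ on the tower rows -/

/-- **L₁ on the tower rows by the split-field KOLYVAGIN ROAD.** PUBLISHED binders as in §1 (`hGZ hKo hKatoT hGZK hmod hnf
hmodP hFH`). HEEGNER-SIDE INPUTS: `hSL` = Kolyvagin's structure theorem at `3`, lower one-class form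
(`AdditiveThree.OneClassLowerBoundShape`; McCallum 1991 Thm. 5.4/5.8 — print, `p ∣ N` reading flagged by its typer); `hInd` =
the MANIN-ROBUST 3-INDIVISIBILITY of the Heegner-point Kolyvagin system within the BSD budget, DISPLAYED: for every
globally minimal `E/ℚ` additive (G) ∧ ss at `3` with `r_an(E) = 1` and `ρ_{E,3^n}` onto for all `n`, every imaginary
quadratic `K′` with `d_{K′} ∉ {−3,−4}` satisfying the Heegner hypothesis for `N_E` with `L(E^{(d_{K′})},1) ≠ 0`, every datum
`(Dt, H, ι)` at level `N_E`, its Heegner point `P` of infinite order, and every globally minimal model `Wd` of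
`E^{(d_{K′})}`: some `m` with `2m ≤ ord₃∏c(E) + ord₃∏c(Wd) + 2·ord₃ c(Dt)` and some genuine Kolyvagin class NOT
`3^{m+1}`-divisible («`M_∞ ≤ ½(ord₃∏c(E) + ord₃∏c(E^{d_{K′}})) + ord₃ c`», the Zhang/BCGS half of the refined Kolyvagin
conjecture read at an additive `3`; OPEN; certifiable pair by pair). CONCLUSION: `Typed.MissingLowerBoundAt E 3` on all
those rows. §1 with `hL'` fed by §2; `d_{K′} ∉ {−3,−4}` from `|d_{K′}| > 4`, non-torsion of `P` from Gross–Zagier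
(`L′(E/K′,1) = L′(E,1)·L(E^{d_{K′}},1) ≠ 0`). [cite: McCallumLMS1991, Thm. 5.4 (p. 288), Thm. 5.8 (p. 290)]
[cite: WZhang2014, Thm. 1.1, Thm. 10.2, Remark 18] [cite: JetchevSkinnerWan2017, §7.4.1 (pp. 29–31)]
[cite: Kato2004Asterisque, Thm. 14.5 (3) (p. 236)] [cite: GrossZagier1986, Thm. I.(6.3) and V.§2] [cite: FriedbergHoffstein1995, Thm. B] -/
theorem gssLowerAtThree_rankOne_towerRows_of_structure_of_indivisibility
    (hGZ : ∀ (N : ℕ) [NeZero N] (W : WeierstrassCurve ℚ) (K : Type) [Field K] [NumberField K],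
      gross_zagier N W K)
    (hKo : ∀ (N : ℕ) [NeZero N] (W : WeierstrassCurve ℚ) (K : Type) [Field K] [NumberField K],
      kolyvagin N W K)
    (hKatoT : Kato2004.rankZero_padicValNat_sha_add_padicValNat_tamagawa_le_of_additive_potGood_of_imageContainsSL2)
    (hGZK : rank_eq_analyticRank_of_analyticRank_le_one) (hmod : hasEntireLFunction_rat)
    (hnf : exists_isNewformOf) (hmodP : nonempty_modularParametrizationData)
    (hFH : friedbergHoffstein_exists_heegnerField_split_twist_ne_zero)
    (hSL : AdditiveThree.OneClassLowerBoundShape)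
    (hInd : ∀ (W : WeierstrassCurve ℚ) [W.IsElliptic] [W.IsGloballyMinimal] [NeZero (W.conductorNorm ℤ)]
      (K : Type) [Field K] [NumberField K]
      (Dt : ModularParametrizationData W (W.conductorNorm ℤ))
      (H : HeegnerDatum (W.conductorNorm ℤ) (NumberField.discr K)) (ι : K →+* ℂ)
      (P : (W.baseChange K).toAffine.Point) (Wd : WeierstrassCurve ℚ) [Wd.IsElliptic] [Wd.IsGloballyMinimal],
      Addv W 3 → SubGss W 3 → W.analyticRank = 1 → (∀ n : ℕ, W.HasSurjectiveModNGaloisRep (3 ^ n : ℕ)) →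
      IsImaginaryQuadratic K → NumberField.discr K ≠ -3 → NumberField.discr K ≠ -4 →
      SatisfiesHeegnerHypothesis (W.conductorNorm ℤ) K →
      (W.quadraticTwist (NumberField.discr K : ℚ)).entireLFunction 1 ≠ 0 →
      WeierstrassCurve.Affine.Point.map ι.toRatAlgHom P = heegnerPointComplex Dt H → ¬ IsOfFinAddOrder P →
      (∃ C : VariableChange ℚ, C • W.quadraticTwist (NumberField.discr K : ℚ) = Wd) →
      ∃ m : ℕ, 2 * m ≤ padicValNat 3 W.tamagawaProduct + padicValNat 3 Wd.tamagawaProduct +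
        2 * padicValNat 3 Dt.c.natAbs ∧ ¬ AdditiveThree.MinftyGe W K Dt H.β ι (m + 1)) :
    ∀ (W : WeierstrassCurve ℚ) [W.IsElliptic] [W.IsGloballyMinimal],
      Addv W 3 → SubGss W 3 → W.analyticRank = 1 →
      (∀ n : ℕ, W.HasSurjectiveModNGaloisRep (3 ^ n : ℕ)) → MissingLowerBoundAt W 3 := by
  refine gssLowerAtThree_rankOne_towerRows_of_adjustedIndexBound hGZ hKo hKatoT hGZK hmod hnf hmodP hFH ?_
  intro W _ _ N _ K _ _ Dt H ι P Wd _ _ Cd hadd hsub hr hsurj hN hK hHN hLt hP hWd _hfin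
  subst hN
  -- `3 ∣ N_E` splits in `K`, so `3 ∤ d_K` and `d_K ≠ -3`
  have h3N : 3 ∣ W.conductorNorm ℤ :=
    (W.dvd_conductorNorm_iff_not_hasGoodReductionAtPrime 3).mpr (not_good_of_addv W 3 hadd)
  have hd3 : ¬ ((3 : ℕ) : ℤ) ∣ NumberField.discr K :=
    not_dvd_discr_of_satisfiesHeegnerHypothesis hK hHN Nat.prime_three h3N
  have h3 : NumberField.discr K ≠ -3 := fun h ↦ hd3 (h ▸ ⟨-1, by norm_num⟩)
  -- `d_K ≠ -4`: `4N ∣ β² − d_K` with `3 ∣ N` would give `β² ≡ −4 ≡ 2 (mod 3)`, not a square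
  have h4 : NumberField.discr K ≠ -4 := by
    intro hK4
    have h12 : (3 : ℤ) ∣ 4 * (W.conductorNorm ℤ : ℤ) := Dvd.dvd.mul_left (by exact_mod_cast h3N) 4
    have h3d : (3 : ℤ) ∣ H.β ^ 2 - NumberField.discr K := dvd_trans h12 H.dvd_sq_sub
    have hcast : ((H.β ^ 2 - NumberField.discr K : ℤ) : ZMod 3) = 0 :=
      (ZMod.intCast_zmod_eq_zero_iff_dvd _ 3).mpr h3d
    have hdK : ((NumberField.discr K : ℤ) : ZMod 3) = -4 := by rw [hK4]; push_cast; ring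
    push_cast at hcast
    rw [hdK] at hcast
    have key : ∀ b : ZMod 3, b ^ 2 - (-4 : ZMod 3) ≠ 0 := by decide
    exact key _ hcast
  -- non-torsion of the Heegner point (Gross–Zagier): `L′(E/K,1) = L′(E,1) · L(E^{d_K},1) ≠ 0`
  have hL0 : W.entireLFunction 1 = 0 := entireLFunction_one_eq_zero_of_analyticRank_eq_one hr
  obtain ⟨-, hderiv⟩ := leadingLCoeff_eq_deriv_of_analyticRank_eq_one hr
  have hLK : LDerivEK W K ≠ 0 := by
    rw [KrizLi2019.lDerivEK_eq_deriv_mul W K hmod hL0]; exact mul_ne_zero hderiv hLt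
  have hnt : ¬ IsOfFinAddOrder P :=
    (lDerivEK_ne_zero_iff_not_isOfFinAddOrder W (W.conductorNorm ℤ) K (hGZ _ W K) hK hHN ⟨Dt, H, ι, hP⟩).mp hLK
  exact adjustedIndexBound_three_of_oneClassLowerBound_of_not_minftyGe hSL W hsurj K hK h3 h4 hHN Dt H ι P hP hnt Wd
    (hInd W K Dt H ι P Wd hadd hsub hr hsurj hK h3 h4 hHN hLt hP hnt ⟨Cd, hWd⟩)

end Summit.BirchSwinnertonDyer.BirchSwinnertonDyer.Theorems.RamifiedPairLowerBound

end
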